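import Mathlib
import Summits.Ventures.HodgeRepro.Tier4.Line4.SliceModelUnitary
import Summits.Ventures.HodgeRepro.Tier4.Line4.ArchSeesawBridge

/-!
# Tier4/Line4/SeesawSigns — C-L4-8-SIGNS: display (8)'s sign data on the seesaw plane from the wall's `_hpos`, and the
ONE explicit definiteness clause `SeesawDefinite`

Blind re-derivation cell `pub-hodge-repro`, Tier 4 (README §9–§10), seat t4-L1-p5 (prover, gen 5; cut by name: plan-4 g6
S15829 (A)).  Target tree path `lean/Summits/Ventures/HodgeRepro/Tier4/Line4/SeesawSigns.lean`.  On L4-p2's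
`SliceModelUnitary` (p711351: `alphaLoc a hw = Φ a_{w₀}`, `betaLoc b ε hw = Φ (ε b)_{w₀}`, `Φ = ringEquivRealOfIsReal hw`)
and this seat's `ArchSeesawBridge` (p708380: `adToC_algebraMap_eq_embedding`, `adToC_algebraMap_mk_of_isReal`); Mathlib's
`InfinitePlace.Completion.extensionEmbeddingOfIsReal_coe`, `InfinitePlace.embedding_of_isReal_apply`,
`InfinitePlace.embedding_mk_eq_of_isReal`.  No printed input.

THE INDEX PAIR.  The line's plane is `seesawPlane q a g g' … = (mixedRow q (a 0) (a 2)).withTransportedTorus g g' …`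
(skeleton v0.41 L843–L847) — the FIRST row `⟨a₀⟩ ⊕ ⟨−a₂⟩`; so L4-p2's `archBallGrowth_mixedRow_withTransportedTorus`
(ArchBallMixed, `W′ = (mixedRow q a b).withTransportedTorus …`) is read at `a := a 0`, `b := a 2` (NOT `(a 1, a 3)`, which
is the second row `U′` — the `T′`-side plane of the (7a) coefficient), and its sign binders are
`hα : 0 < alphaLoc (a 0) hw`, `hβ : betaLoc (a 2) (−1) hw < 0`,
`hdef : ∀ w′ ≠ w₀, w′.IsReal ∧ IsCMAt q w′ ∧ 0 < (adToC w′ (a 0)).re · (adToC w′ (−1 * a 2)).re`.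

WHAT IS PROVED (kernel, no print): **`alphaLoc_eq_re`** / **`betaLoc_eq_re`** (`alphaLoc a hw = (embedding w₀ a).re`,
`betaLoc b ε hw = (embedding w₀ (ε * b)).re`: the completion's real coordinate IS the real part of the real embedding),
`alphaLoc_mk_eq_re` / `betaLoc_mk_eq_re` at `w₀ = mk φ`, **`alphaLoc_pos_of_hpos`** / **`betaLoc_neg_of_hpos`** (the
wall's `_hpos : ∀ i, 0 < (φ (a i)).re` at `i = 0, 2` IS `hα`, `hβ` at the place `mk φ` of `τ₀`), **`SeesawDefinite q a w₀`**
(the ONE explicit clause: definiteness of the seesaw plane at every real CM place `w′ ≠ w₀`, in the exact shape of L4-p2's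
`hdef`), **`hdef_of_seesawDefinite`** (`= id`), `seesawDefinite_of_forall_sign` (with total reality and `hcm : ∀ w, IsCMAt q w`
— both (7a)/(7b)-binders — `SeesawDefinite` is the SIGN clause alone), `seesawDefinite_iff_embedding` (the sign clause in
terms of the real embeddings: `0 < (embedding w′ (a 0)).re · (embedding w′ (−1 * a 2)).re`), and
`not_seesawDefinite_at_w₀`-type sanity: at `w₀` itself the plane is INDEFINITE under `_hpos` (`sign_at_w₀_neg`).
Nothing here says anything about the status of the Hodge conjecture for CM abelian varieties, which is NOT proved
(HC_CM is NOT proved by anyone in this repository).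
-/

set_option autoImplicit false

noncomputable section

namespace Summit.Ventures.HodgeRepro.Tier4.Line4

open Summit.Ventures.HodgeRepro.Tier4.Common NumberField

section Signs

variable {k : Type} [Field k]

/-- **the completion's real coordinate is the real part of the real embedding**: `alphaLoc a hw = (embedding w₀ a).re`. -/
theorem alphaLoc_eq_re {w₀ : InfinitePlace k} (hw : w₀.IsReal) (a : k) :
    alphaLoc a hw = (InfinitePlace.embedding w₀ a).re := by
  unfold alphaLoc
  rw [InfinitePlace.Completion.ringEquivRealOfIsReal_apply, InfinitePlace.Completion.algebraMap_apply,
    InfinitePlace.Completion.extensionEmbeddingOfIsReal_coe, ← WithAbs.equiv_symm_apply, RingEquiv.apply_symm_apply,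
    ← InfinitePlace.embedding_of_isReal_apply hw a, Complex.ofReal_re]

/-- `betaLoc b ε hw = (embedding w₀ (ε * b)).re`. -/
theorem betaLoc_eq_re {w₀ : InfinitePlace k} (hw : w₀.IsReal) (b ε : k) :
    betaLoc b ε hw = (InfinitePlace.embedding w₀ (ε * b)).re := by
  unfold betaLoc
  rw [InfinitePlace.Completion.ringEquivRealOfIsReal_apply, InfinitePlace.Completion.algebraMap_apply,
    InfinitePlace.Completion.extensionEmbeddingOfIsReal_coe, ← WithAbs.equiv_symm_apply, RingEquiv.apply_symm_apply,
    ← InfinitePlace.embedding_of_isReal_apply hw (ε * b), Complex.ofReal_re]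

/-- at the place `mk φ` of a real embedding `φ`: `alphaLoc a hw = (φ a).re`. -/
theorem alphaLoc_mk_eq_re (φ : k →+* ℂ) (hw : (InfinitePlace.mk φ).IsReal) (a : k) :
    alphaLoc a hw = (φ a).re := by
  rw [alphaLoc_eq_re, InfinitePlace.embedding_mk_eq_of_isReal (InfinitePlace.isReal_mk_iff.1 hw)]

/-- `betaLoc b ε hw = (φ (ε * b)).re` at `mk φ`. -/
theorem betaLoc_mk_eq_re (φ : k →+* ℂ) (hw : (InfinitePlace.mk φ).IsReal) (b ε : k) :
    betaLoc b ε hw = (φ (ε * b)).re := by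
  rw [betaLoc_eq_re, InfinitePlace.embedding_mk_eq_of_isReal (InfinitePlace.isReal_mk_iff.1 hw)]

/-- **`hα` from the wall's `_hpos`**: `0 < alphaLoc (a 0) hw` at the place `mk φ` of `τ₀` (`i = 0`). -/
theorem alphaLoc_pos_of_hpos (φ : k →+* ℂ) (hw : (InfinitePlace.mk φ).IsReal) (a : Fin 4 → k)
    (hpos : ∀ i, 0 < (φ (a i)).re) : 0 < alphaLoc (a 0) hw := by
  rw [alphaLoc_mk_eq_re]
  exact hpos 0

/-- **`hβ` from the wall's `_hpos`**: `betaLoc (a 2) (−1) hw < 0` at the place `mk φ` of `τ₀` (`i = 2`). -/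
theorem betaLoc_neg_of_hpos (φ : k →+* ℂ) (hw : (InfinitePlace.mk φ).IsReal) (a : Fin 4 → k)
    (hpos : ∀ i, 0 < (φ (a i)).re) : betaLoc (a 2) (-1) hw < 0 := by
  rw [betaLoc_mk_eq_re, neg_one_mul, map_neg, Complex.neg_re]
  exact neg_neg_of_pos (hpos 2)

/-- the same two signs for the second row `(a 1, a 3)` (the `T′`-side plane of the (7a) coefficient), for the record. -/
theorem alphaLoc_pos_of_hpos' (φ : k →+* ℂ) (hw : (InfinitePlace.mk φ).IsReal) (a : Fin 4 → k)
    (hpos : ∀ i, 0 < (φ (a i)).re) : 0 < alphaLoc (a 1) hw := by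
  rw [alphaLoc_mk_eq_re]
  exact hpos 1

/-- `betaLoc (a 3) (−1) hw < 0`. -/
theorem betaLoc_neg_of_hpos' (φ : k →+* ℂ) (hw : (InfinitePlace.mk φ).IsReal) (a : Fin 4 → k)
    (hpos : ∀ i, 0 < (φ (a i)).re) : betaLoc (a 3) (-1) hw < 0 := by
  rw [betaLoc_mk_eq_re, neg_one_mul, map_neg, Complex.neg_re]
  exact neg_neg_of_pos (hpos 3)

end Signs

section Definite

variable {k : Type} [Field k] [NumberField k]

/-- **THE ONE EXPLICIT DEFINITENESS CLAUSE OF DISPLAY (8)**: at every infinite place `w′ ≠ w₀` the seesaw plane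
`⟨a₀⟩ ⊕ ⟨−a₂⟩` is real, CM and DEFINITE — `0 < (a 0)_{w′} · (−a 2)_{w′}` — in the exact binder shape of L4-p2's
`archBallGrowth_mixedRow_withTransportedTorus` (`hdef`, at `a := a 0`, `b := a 2`).  NOT implied by the wall (`_hpos`
speaks at `τ₀` only; R-8-SIGN): the binder the wall and (8) carry. -/
def SeesawDefinite (q : QuadData k) (a : Fin 4 → k) (w₀ : InfinitePlace k) : Prop :=
  ∀ w' : InfinitePlace k, w' ≠ w₀ → w'.IsReal ∧ IsCMAt q w' ∧
    0 < (adToC w' (algebraMap k (Ad k) (a 0))).re * (adToC w' (algebraMap k (Ad k) (-1 * a 2))).re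

/-- `SeesawDefinite` IS L4-p2's `hdef` (the unfolded clause). -/
theorem hdef_of_seesawDefinite {q : QuadData k} {a : Fin 4 → k} {w₀ : InfinitePlace k} (h : SeesawDefinite q a w₀) :
    ∀ w' : InfinitePlace k, w' ≠ w₀ → w'.IsReal ∧ IsCMAt q w' ∧
      0 < (adToC w' (algebraMap k (Ad k) (a 0))).re * (adToC w' (algebraMap k (Ad k) (-1 * a 2))).re := h

/-- with total reality and `hcm : ∀ w, IsCMAt q w` (both (7a)/(7b)-binders), `SeesawDefinite` is the SIGN clause alone. -/
theorem seesawDefinite_of_forall_sign {q : QuadData k} {a : Fin 4 → k} {w₀ : InfinitePlace k}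
    (hreal : ∀ w : InfinitePlace k, w.IsReal) (hcm : ∀ w, IsCMAt q w)
    (hsign : ∀ w' : InfinitePlace k, w' ≠ w₀ →
      0 < (adToC w' (algebraMap k (Ad k) (a 0))).re * (adToC w' (algebraMap k (Ad k) (-1 * a 2))).re) :
    SeesawDefinite q a w₀ :=
  fun w' hw' => ⟨hreal w', hcm w', hsign w' hw'⟩

/-- the sign clause in terms of the real embeddings: `(adToC w′ (algebraMap x)).re = (embedding w′ x).re`. -/
theorem seesawDefinite_iff_embedding (q : QuadData k) (a : Fin 4 → k) (w₀ : InfinitePlace k) :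
    SeesawDefinite q a w₀ ↔ ∀ w' : InfinitePlace k, w' ≠ w₀ → w'.IsReal ∧ IsCMAt q w' ∧
      0 < (InfinitePlace.embedding w' (a 0)).re * (InfinitePlace.embedding w' (-1 * a 2)).re := by
  unfold SeesawDefinite
  simp only [adToC_algebraMap_eq_embedding]

/-- **at `w₀ = mk φ` itself the plane is INDEFINITE under `_hpos`**: `(a 0)_{w₀} · (−a 2)_{w₀} < 0` — the reason the
definiteness clause is asked at `w′ ≠ w₀` only (the `SL₂`-ball place). -/
theorem sign_at_w₀_neg (φ : k →+* ℂ) (hφ : ComplexEmbedding.IsReal φ) (a : Fin 4 → k)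
    (hpos : ∀ i, 0 < (φ (a i)).re) :
    (adToC (InfinitePlace.mk φ) (algebraMap k (Ad k) (a 0))).re *
      (adToC (InfinitePlace.mk φ) (algebraMap k (Ad k) (-1 * a 2))).re < 0 := by
  rw [adToC_algebraMap_mk_of_isReal φ hφ, adToC_algebraMap_mk_of_isReal φ hφ, neg_one_mul, map_neg, Complex.neg_re]
  exact mul_neg_of_pos_of_neg (hpos 0) (neg_neg_of_pos (hpos 2))

end Definite

end Summit.Ventures.HodgeRepro.Tier4.Line4

end
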